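import Summits.BirchSwinnertonDyer.BirchSwinnertonDyer.Theorems.TwoAdicConverseOrdLambdaHalfAtTwoThetaSupplyOfInputs
import Summits.BirchSwinnertonDyer.BirchSwinnertonDyer.Theorems.TwoAdicConverseOrdLambdaHalfAtTwoShapiroPTOfFacts
import HarnessLib

/-!
# Route `TwoAdicConverse` (rung S3), crux `OrdLambdaHalfAtTwo` (item stmt-BirchSwinnertonDyer-19556), line `kato_determinant_greenberg_two`
# (skeleton v4.7): stub 4‴ `ThetaShapiroKatoGreenbergSupplyAtTwo` from SEVEN PRINTED NAMED FACTS and the ONE remaining memo binder (S)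

Cell `bsd-2adic`, seat `bsd-2adic-conv-1` GEN 31 (`--supports stmt-BirchSwinnertonDyer-19556 --as helper`).  Composition of
`TwoAdicThetaSupply.thetaShapiroKatoGreenbergSupplyAtTwo_of_inputs` (p701530) with `TwoAdicShapiroLattice.shapiroLatticePoitouTateAtTwoTheta_of_facts`
(the (PT) binder from `Kato2004.thm12_4` + `Kato2004.poitouTate_shapiroLattice_bdp_two`, p702717): the registered construction stub 4‴ follows from

| input | what |
|---|---|
| `Literature.Uncategorized.OrdConversePublishedInputsAtTwo` | PUB = the line's `stub_pub` (item 19167) |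
| `Kato2004.exists_zetaClass_colemanMinus_recLaw_index_two` | Kato 12.4/12.5/16.6/17.11/§17.13 at `2`, per curve (p681779) |
| `Kato2004.tateModuleFilAt_inertia_ordinary` | inertia on `F⁺`/`T/F⁺` at good ordinary `2` (p698222) |
| `Kato2004.localIwasawaH1_tateRep_moduleFinite` | (12.2.3) |
| `Kato2004_fineSelmerDual_isTorsion` | `X₀(E/ℚ_∞)` torsion |
| `Kato2004.thm12_4` | Thm 12.4 (2): `𝐇¹_Γ` torsion free |
| `Kato2004.poitouTate_shapiroLattice_bdp_two` | Poitou–Tate over `K_∞` with the Shapiro lattice + `loc_w̄` injective under cotorsion (p702717) |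
| `TwoAdicShapiroPT.LambdaShapiroFineAtTwo` | (S) — the ONLY remaining memo binder (λ-Shapiro for the fine duals) |

HONEST FRAMING.  THEOREM ONLY (a composition); no definition, no named fact, no `sorry`; CONDITIONAL on the eight named inputs; the crux is NOT proved
here (6‴ is research); BSD is not proved by any of this.  PARTITION (D-0054): none — RANK axis S3 × X5@2 stratum (β); closes none (the lead closes
registered stubs).
-/

set_option linter.dupNamespace false
set_option autoImplicit false

namespace Summit.BirchSwinnertonDyer.BirchSwinnertonDyer.Theorems.TwoAdicThetaSupply

open Literature.NumberTheory.EllipticCurves Literature.NumberTheory.EllipticCurves.Kato2004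
open Summit.BirchSwinnertonDyer.BirchSwinnertonDyer.Theorems.TwoAdicKatoDeterminant
open Summit.BirchSwinnertonDyer.BirchSwinnertonDyer.Theorems.TwoAdicShapiroPT
open Summit.BirchSwinnertonDyer.BirchSwinnertonDyer.Theorems.TwoAdicShapiroLattice

/-- **STUB 4‴ FROM PRINT + (S)**: `ThetaShapiroKatoGreenbergSupplyAtTwo` from seven printed named facts (PUB, F3-K, ORD, (12.2.3), X₀-torsion,
Kato Thm 12.4 (2), the Poitou–Tate reading at `2`) and the single memo binder (S) `LambdaShapiroFineAtTwo`.
[cite: Kato2004Asterisque, Thm 12.4, 12.5, 16.6, Prop 17.11, §17.13] [cite: Nekovar2006, 8.9.6.1–8.9.6.2 (p. 240)] [cite: GreenbergLNM1716, §2, §4 p. 107] -/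
theorem thetaShapiroKatoGreenbergSupplyAtTwo_of_print
    (hPub : Literature.Uncategorized.OrdConversePublishedInputsAtTwo)
    (hF3K : Kato2004.exists_zetaClass_colemanMinus_recLaw_index_two)
    (hOrd : Kato2004.tateModuleFilAt_inertia_ordinary)
    (hHl : Kato2004.localIwasawaH1_tateRep_moduleFinite)
    (hX₀ : Kato2004_fineSelmerDual_isTorsion)
    (h124 : Kato2004.thm12_4)
    (hPTK : Kato2004.poitouTate_shapiroLattice_bdp_two)
    (hS : LambdaShapiroFineAtTwo) :
    ThetaShapiroKatoGreenbergSupplyAtTwo :=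
  thetaShapiroKatoGreenbergSupplyAtTwo_of_inputs hPub hF3K hOrd hHl hX₀ hS (shapiroLatticePoitouTateAtTwoTheta_of_facts h124 hPTK)

end Summit.BirchSwinnertonDyer.BirchSwinnertonDyer.Theorems.TwoAdicThetaSupply
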